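import Mathlib
import Summits.Ventures.PercRepro.TriangleCapSevenTen

/-!
# PercRepro — THE CELL `(6, 9) = 18` OF THE `K₄⁻`-FREE CHERRY TABLE, AND THE ROW `m = k + 3` EXACT FOR EVERY `k`
(p3, gen 32; part 18 — the last census cell of the row `m = k + 3`)

At `(k, m) = (6, 9)` the bipartite competitor `K_{2,5}` plus pendants does not exist (`k < t + 3`) and the census
reads `18 = K_{3,3}` — the star value `C(5, 2) + 8` by coincidence, attained with every degree `≤ 3`.  The proof
is structural, not the count: a `K₄⁻`-free graph with `9` edges on `6` vertices has NO vertex of degree `≥ 4`.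
Degree `5` would leave `4` edges inside a neighbourhood of `5` vertices, which induces a matching; degree `4`
leaves one non-neighbour `u` and `5` edges off `v` — the `M` matching edges inside `N(v)` and the edges at `u`,
all of which go to `N(v)` — and **`two_mul_card_filter_adj_add_card_T_le_two_mul_deg`**: a non-neighbour `u` of `v`
is adjacent to at most `d(v) − M` vertices of `N(v)`, because each matching edge carries at most one of them
(`v` and `u` would otherwise be two common neighbours of an adjacent pair; `K₄⁻`).  So `5 ≤ M + (4 − M) = 4`,
impossible; with every degree `≤ 3`, `Σ_v C(d(v), 2) ≤ Σ_v d(v) = 18`.  With TriangleCapSevenTen the row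
`m = k + 3` is then a theorem for EVERY `k` (**`row_plus_three_all`**): empty for `k ≤ 5` (a `K₄⁻`-free graph on
`k ≤ 5` vertices has at most `k + 1` edges), `18` at `k = 6`, `25` at `k = 7`, `30` at `k = 8`, the star value
`C(k − 1, 2) + 8` from `k = 9` on.  Axioms: standard.
-/

namespace PercRepro

namespace TriangleCap

namespace C047

open Finset

variable {V : Type*} [Fintype V] [DecidableEq V]

/-- **A vertex `u ≠ v` is adjacent to at most `d(v) − M` vertices of `N(v)`** (`T = 2M` the ordered matching
pairs inside `N(v)`; each matching edge carries at most one neighbour of `u`): `2·#(N(v) ∩ N(u)) + T ≤ 2·d(v)`. -/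
theorem two_mul_card_filter_adj_add_card_T_le_two_mul_deg (D : SimpleGraph V) [DecidableRel D.Adj]
    (hK : K4mFree D) {v u : V} (hne : u ≠ v) :
    2 * ((univ.filter (fun x => D.Adj v x)).filter (fun x => D.Adj u x)).card +
      ((offPairs D v).filter (fun p => D.Adj v p.1 ∧ D.Adj v p.2)).card ≤ 2 * deg D v := by
  set Tf := (offPairs D v).filter (fun p => D.Adj v p.1 ∧ D.Adj v p.2) with hTf
  set A := (univ.filter (fun x => D.Adj v x)).filter (fun x => D.Adj u x) with hA
  set VM := Tf.image Prod.fst with hVM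
  -- the matched vertices: `|VM| = T` (a matching pair is determined by its first coordinate)
  have hinj : Set.InjOn Prod.fst (Tf : Set (V × V)) := by
    intro q hq q' hq' he
    rw [mem_coe] at hq hq'
    have h1 := card_filter_T_fst_le_one D hK v q.1
    rw [card_le_one] at h1
    exact h1 q (mem_filter.mpr ⟨hq, rfl⟩) q' (mem_filter.mpr ⟨hq', he.symm⟩)
  have hVMcard : VM.card = Tf.card := card_image_of_injOn hinj
  have hVMsub : VM ⊆ univ.filter (fun x => D.Adj v x) := by
    intro x hx
    rw [hVM, mem_image] at hx
    obtain ⟨q, hq, rfl⟩ := hx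
    rw [hTf, mem_filter] at hq
    exact mem_filter.mpr ⟨mem_univ _, hq.2.1⟩
  -- the matching pairs starting in `A`: disjoint from their swaps (no matching edge has both ends in `N(u)`)
  set P := Tf.filter (fun q => q.1 ∈ A) with hP
  have hPswap : Disjoint P (P.image Prod.swap) := by
    rw [disjoint_left]
    intro q hq hq'
    rw [hP, mem_filter] at hq
    rw [mem_image] at hq'
    obtain ⟨q', hq', hqq'⟩ := hq'
    rw [hP, mem_filter] at hq'
    rw [← hqq'] at hq
    rw [hTf, mem_filter, mem_offPairs] at hq'
    obtain ⟨⟨hadj, -, -⟩, hv1, hv2⟩ := hq'.1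
    have hA1 : q'.1 ∈ A := hq'.2
    have hA2 : q'.2 ∈ A := by simpa [Prod.fst_swap] using hq.2
    rw [hA, mem_filter, mem_filter] at hA1 hA2
    -- `v` and `u` are two common neighbours of the adjacent `q'.1, q'.2`
    have hle := card_inter_le_one_of_adj D hK hadj
    have hmem1 : u ∈ (univ.filter (fun x => D.Adj q'.1 x)) ∩ (univ.filter (fun x => D.Adj q'.2 x)) :=
      mem_inter.mpr ⟨mem_filter.mpr ⟨mem_univ _, hA1.2.symm⟩, mem_filter.mpr ⟨mem_univ _, hA2.2.symm⟩⟩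
    have hmem2 : v ∈ (univ.filter (fun x => D.Adj q'.1 x)) ∩ (univ.filter (fun x => D.Adj q'.2 x)) :=
      mem_inter.mpr ⟨mem_filter.mpr ⟨mem_univ _, hv1.symm⟩, mem_filter.mpr ⟨mem_univ _, hv2.symm⟩⟩
    have hsub := card_le_card (insert_subset hmem1 (singleton_subset_iff.mpr hmem2))
    rw [card_insert_of_notMem (by simpa using hne), card_singleton] at hsub
    omega
  have hPsub : P ∪ P.image Prod.swap ⊆ Tf := by
    apply union_subset (filter_subset _ _)
    intro q hq
    rw [mem_image] at hq
    obtain ⟨q', hq', rfl⟩ := hq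
    rw [hP, mem_filter] at hq'
    exact swap_mem_T D v hq'.1
  have hPcard : P.card + (P.image Prod.swap).card ≤ Tf.card := by
    have h := card_union_add_card_inter P (P.image Prod.swap)
    rw [disjoint_iff_inter_eq_empty.mp hPswap, card_empty] at h
    have h' := card_le_card hPsub
    omega
  have hPswapcard : (P.image Prod.swap).card = P.card :=
    card_image_of_injective _ Prod.swap_injective
  -- `A ∩ VM ⊆ P.image fst`, `A \ VM ⊆ N(v) \ VM`
  have h1 : (A ∩ VM).card ≤ P.card := by
    refine (card_le_card ?_).trans (card_image_le (s := P) (f := Prod.fst))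
    intro x hx
    rw [mem_inter] at hx
    rw [hVM, mem_image] at hx
    obtain ⟨q, hq, rfl⟩ := hx.2
    rw [mem_image]
    exact ⟨q, mem_filter.mpr ⟨hq, hx.1⟩, rfl⟩
  have h2 : (A \ VM).card ≤ (univ.filter (fun x => D.Adj v x) \ VM).card := by
    apply card_le_card
    intro x hx
    rw [mem_sdiff] at hx ⊢
    rw [hA, mem_filter] at hx
    exact ⟨hx.1.1, hx.2⟩
  have h3 := card_sdiff_add_card_inter A VM
  have h4 := card_sdiff_of_subset hVMsub
  rw [h4] at h2
  have hTle : VM.card ≤ (univ.filter (fun x => D.Adj v x)).card := card_le_card hVMsub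
  unfold deg
  omega

/-- **The cell `(6, 9)`, no vertex of degree `≥ 4`:** a `K₄⁻`-free graph with `9` edges on `6` vertices has
every degree `≤ 3`. -/
theorem deg_le_three_of_k4mFree_six_nine (D : SimpleGraph V) [DecidableRel D.Adj] (hK : K4mFree D)
    (hk : Fintype.card V = 6) (hm : D.edgeFinset.card = 9) (v : V) : deg D v ≤ 3 := by
  by_contra hv
  push Not at hv
  have hdk : deg D v + 1 ≤ Fintype.card V := by
    have hsub : univ.filter (fun w => D.Adj v w) ⊆ univ.erase v := by
      intro w hw
      rw [mem_filter] at hw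
      rw [mem_erase]
      exact ⟨(D.ne_of_adj hw.2).symm, mem_univ _⟩
    have h1 : deg D v ≤ (univ.erase v).card := card_le_card hsub
    rw [card_erase_of_mem (mem_univ v), card_univ] at h1
    omega
  have hT := card_T_le_deg D hK v
  have hRc := two_mul_card_edges_eq D v
  have hEc := card_offEdges D v
  rcases (by omega : deg D v = 5 ∨ deg D v = 4) with h5 | h4
  · -- dominating: the `4` edges off `v` are a matching inside `N(v)`: `T = 8 > 5`
    have hdom := congrArg card (filter_T_eq_offPairs_of_deg_add_one_eq_card D (v := v) (by omega))
    omega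
  · -- one non-neighbour `u`; the edges off `v` are the matching edges and the edges at `u`
    have hu : ∃ u, ¬ D.Adj v u ∧ u ≠ v := by
      by_contra hno
      push Not at hno
      have : univ.erase v ⊆ univ.filter (fun w => D.Adj v w) := by
        intro w hw
        rw [mem_erase] at hw
        exact mem_filter.mpr ⟨mem_univ _, by_contra (fun h => hw.1 (hno w h))⟩
      have := card_le_card this
      rw [card_erase_of_mem (mem_univ v), card_univ] at this
      unfold deg at h4
      omega
    obtain ⟨u, hvu, hne⟩ := hu
    -- every vertex other than `v`, `u` is a neighbour of `v`
    have hall : ∀ x, x ≠ v → x ≠ u → D.Adj v x := by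
      intro x hxv hxu
      by_contra hx
      have hsub : insert u (insert x (univ.filter (fun w => D.Adj v w))) ⊆ univ.erase v := by
        intro w hw
        rw [mem_insert, mem_insert, mem_filter] at hw
        rw [mem_erase]
        rcases hw with rfl | rfl | hw
        · exact ⟨hne, mem_univ _⟩
        · exact ⟨hxv, mem_univ _⟩
        · exact ⟨(D.ne_of_adj hw.2).symm, mem_univ _⟩
      have hc := card_le_card hsub
      rw [card_erase_of_mem (mem_univ v), card_univ, card_insert_of_notMem (by
          intro hmem
          rw [mem_insert, mem_filter] at hmem
          rcases hmem with h | ⟨-, h⟩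
          · exact hxu h.symm
          · exact hvu h),
        card_insert_of_notMem (by rw [mem_filter]; exact fun h => hx h.2)] at hc
      unfold deg at h4
      omega
    -- the edges off `v` not at `u` are matching edges: at most `M` of them
    have hoff := card_filter_not_mem_offEdges D v u
    have hM : ((offEdges D v).filter (fun e => u ∉ e)).card ≤
        (((offPairs D v).filter (fun p => D.Adj v p.1 ∧ D.Adj v p.2)).image
          (fun q => s(q.1, q.2))).card := by
      apply card_le_card
      intro e he
      rw [mem_filter, mem_offEdges] at he
      obtain ⟨⟨he1, hev⟩, heu⟩ := he
      induction e using Sym2.ind with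
      | _ x y =>
        rw [SimpleGraph.mem_edgeFinset, SimpleGraph.mem_edgeSet] at he1
        rw [Sym2.mem_iff] at hev heu
        push Not at hev heu
        rw [mem_image]
        refine ⟨(x, y), ?_, rfl⟩
        rw [mem_filter, mem_offPairs]
        exact ⟨⟨he1, fun h => hev.1 h.symm, fun h => hev.2 h.symm⟩, hall x (Ne.symm hev.1) (Ne.symm heu.1),
          hall y (Ne.symm hev.2) (Ne.symm heu.2)⟩
    have hTM := card_T_eq_two_mul D v
    -- the off-degree of `u` is its number of neighbours in `N(v)`
    have hout : outDeg D v u ≤ ((univ.filter (fun x => D.Adj v x)).filter (fun x => D.Adj u x)).card := by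
      unfold outDeg
      refine (card_le_card_of_injOn Prod.snd ?_ ?_)
      · intro p hp
        rw [mem_coe, mem_filter, mem_offPairs] at hp
        obtain ⟨⟨hadj, -, hp2⟩, hpu⟩ := hp
        rw [hpu] at hadj
        rw [mem_coe, mem_filter, mem_filter]
        refine ⟨⟨mem_univ _, hall p.2 hp2 ?_⟩, hadj⟩
        rintro rfl
        exact D.irrefl hadj
      · intro p hp p' hp' he
        rw [mem_coe, mem_filter] at hp hp'
        exact Prod.ext (hp.2.trans hp'.2.symm) he
    have hL4 := two_mul_card_filter_adj_add_card_T_le_two_mul_deg D hK hne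
    omega

/-- **THE CELL `(6, 9)`, THE BOUND:** every `K₄⁻`-free graph with `9` edges on `6` vertices has
`Σ_v C(d(v), 2) ≤ 18`. -/
theorem cherries_le_eighteen_of_k4mFree (D : SimpleGraph V) [DecidableRel D.Adj] (hK : K4mFree D)
    (hk : Fintype.card V = 6) (hm : D.edgeFinset.card = 9) : cherries D ≤ 18 := by
  have h2 : 2 * cherries D ≤ (3 - 1) * ∑ v, deg D v := by
    unfold cherries
    rw [mul_sum, mul_sum]
    exact sum_le_sum (fun v _ => two_mul_choose_two_le_pred_mul _ _
      (deg_le_three_of_k4mFree_six_nine D hK hk hm v))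
  rw [sum_deg_eq, hm] at h2
  omega

/-- `K_{3,3}` on `Fin 6`: `{0, 1, 2}` against `{3, 4, 5}`. -/
def bipThreeThree : SimpleGraph (Fin 6) where
  Adj i j := (i.val < 3 ∧ 3 ≤ j.val) ∨ (j.val < 3 ∧ 3 ≤ i.val)
  symm := ⟨by decide⟩
  loopless := ⟨by decide⟩

/-- Adjacency in `K_{3,3}` is decidable. -/
instance decidableRelBipThreeThree : DecidableRel bipThreeThree.Adj :=
  fun i j => inferInstanceAs (Decidable ((i.val < 3 ∧ 3 ≤ j.val) ∨ (j.val < 3 ∧ 3 ≤ i.val)))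

/-- `K_{3,3}` is `K₄⁻`-free (every `4`-set carries at most `8` ordered adjacent pairs; decided). -/
theorem k4mFree_bipThreeThree : K4mFree bipThreeThree := by
  unfold K4mFree
  decide

/-- `Σ_v C(d(v), 2) = 6·C(3, 2) = 18` on `K_{3,3}`. -/
theorem cherries_bipThreeThree : cherries bipThreeThree = 18 := by decide

/-- `Σ_v d(v) = 18` on `K_{3,3}`. -/
theorem sum_deg_bipThreeThree : ∑ v, deg bipThreeThree v = 18 := by decide

/-- `K_{3,3}` has `9` edges (handshake). -/
theorem card_edges_bipThreeThree : bipThreeThree.edgeFinset.card = 9 := by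
  have h := sum_deg_eq bipThreeThree
  rw [sum_deg_bipThreeThree] at h
  omega

/-- **THE CELL `(6, 9) = 18`, EXACT:** every `K₄⁻`-free graph with `9` edges on `6` vertices has
`Σ_v C(d(v), 2) ≤ 18`, and `K_{3,3}` attains it. -/
theorem six_nine_exact :
    (∀ (D : SimpleGraph (Fin 6)) [DecidableRel D.Adj], K4mFree D → D.edgeFinset.card = 9 →
        cherries D ≤ 18) ∧
      ∃ (D : SimpleGraph (Fin 6)) (_ : DecidableRel D.Adj),
        K4mFree D ∧ D.edgeFinset.card = 9 ∧ cherries D = 18 :=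
  ⟨fun D _ hK hD => cherries_le_eighteen_of_k4mFree D hK (by simp) hD,
    bipThreeThree, inferInstance, k4mFree_bipThreeThree, card_edges_bipThreeThree, cherries_bipThreeThree⟩

/-- **THE ROW `m = k + 3` OF THE `K₄⁻`-FREE CHERRY TABLE, EXACT FOR EVERY `k ≥ 6`:** `18` at `k = 6` (`K_{3,3}`),
`25` at `k = 7` (`K_{2,5}`), `30` at `k = 8` (`K_{2,5}` plus a pendant edge), and the star value `C(k − 1, 2) + 8`
(the star plus four disjoint leaf edges) from `k = 9` on — written as `C(k − 1, 2) + 8 + [2, 1, 0]` at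
`k = 7, 8, ≥ 9` and `C(5, 2) + 8 = 18` at `k = 6`.  (For `k ≤ 5` no `K₄⁻`-free graph has `k + 3` edges: the
census table ends at `(5, 6)`; not stated here.) -/
theorem row_plus_three_all (k : ℕ) (hk : 6 ≤ k) :
    (∀ (D : SimpleGraph (Fin k)) [DecidableRel D.Adj], K4mFree D → D.edgeFinset.card = k + 3 →
        cherries D ≤ (k - 1).choose 2 + 8 + (if k = 7 then 2 else if k = 8 then 1 else 0)) ∧
      ∃ (D : SimpleGraph (Fin k)) (_ : DecidableRel D.Adj), K4mFree D ∧ D.edgeFinset.card = k + 3 ∧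
        cherries D = (k - 1).choose 2 + 8 + (if k = 7 then 2 else if k = 8 then 1 else 0) := by
  rcases (by omega : k = 6 ∨ 7 ≤ k) with rfl | h7
  · obtain ⟨h1, D, inst, hK, hD, hc⟩ := six_nine_exact
    have e : (6 - 1).choose 2 = 10 := by decide
    refine ⟨fun D _ hK hD => ?_, D, inst, hK, hD, ?_⟩
    · have := h1 D hK hD
      simp only [show (6 : ℕ) ≠ 7 from by decide, show (6 : ℕ) ≠ 8 from by decide, if_false]
      omega
    · simp only [show (6 : ℕ) ≠ 7 from by decide, show (6 : ℕ) ≠ 8 from by decide, if_false]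
      omega
  · exact row_plus_three_from_seven k h7

end C047

end TriangleCap

end PercRepro
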